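import Summits.HodgeConjecture.HodgeConjecture.Theorems.Ring2AbelianAllAndreCorrespondenceCategory
import Summits.HodgeConjecture.HodgeConjecture.Theorems.HeckePrymWeilSummitOffWeilSectorLefschetzBInstances
import Literature.AlgebraicGeometry.HodgeTheory.LefschetzStandardUnconditionalDegrees
import Literature.AlgebraicGeometry.HodgeTheory.LefschetzDecompositionPolarizationForm
import HarnessLib

/-!
# Crux `LefschetzStandardB` (stmt-HodgeConjecture-17489), line `birth` — towards stub 3 `stub_charlesSpread`, I:
# the projections onto the LEFSCHETZ COMPONENTS of `Hᵇ(S(ℂ); ℂ)` are algebraic correspondences, granted `B(S)` in the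
# target degrees `≤ b − 2` (Charles 2013, Lemma 7)

Route `HodgeConjecture/MotivatedLefschetzSplit`, crux #3 `LefschetzStandardB`; registered skeleton
`Cruxes/LefschetzStandardB/Lines/birth.lean`. Stub 3 (`stub_charlesSpread`, Charles 2013 Prop. 8 ⇐) consumes, on the
parameter variety `S` of a family supply, "the projections onto the Lefschetz components of `Hᵇ(S)`, hence the sign
operator `s`, are algebraic" — Charles's Lemma 7, whose input is conjecture `B(S)` in the target degrees `b' ≤ b − 2`.
This file proves that lemma on the tree's real carriers, for a smooth projective `S` of dimension `l`, a polarisation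
class `κ` (`IsPolarizationClass`: rational, divisor-supported, hard Lefschetz) and a degree `b ≤ l`:

* §1 bookkeeping: `IsAlgebraicCorrespondence` is stable under precomposition with `lefschetzPowTo` (explicit target
  degree) and contains the identity and the Lefschetz iterates;
* §2 **the one-step descent of the Lefschetz decomposition** (Voisin I Cor. 6.26, made effective): for `b = c + 2 ≤ l`
  and `c + j = l`, the operator `R := *_L ∘ L^{j-1} : H^{c+2} → Hᶜ` (`*_L : H^{c+2j} → Hᶜ` the inverse Lefschetz
  isomorphism) satisfies `ξ_{(c+2,0)} x = x − L (R x)` (`primitivePart_top_eq_sub`) and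
  `ξ_{(a,t+1)} x = ξ_{(a,t)} (R x)` (`primitivePart_succ_eq`) — the primitive parts `ξ_p` being the tree's
  `primitivePart` (`LefschetzDecompositionPolarizationForm`);
* §3 **`isAlgebraicCorrespondence_lefschetzProjection`**: if `*_L : Hᵃ'(S) → Hᵇ'(S)` is an algebraic correspondence
  for all `a' + b' = 2l` with `b' + 2 ≤ b`, then for every Lefschetz index `p = (a, t)`, `a + 2t = b`, the projection
  `Lᵗ ∘ ξ_p : Hᵇ(S(ℂ); ℂ) → Hᵇ(S(ℂ); ℂ)` onto the component `Lᵗ Pᵃ` is an algebraic correspondence (strong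
  induction on `b`: `π_{(b,0)} = 𝟙 − L ∘ R`, `π_{(a,t+1)} = L ∘ π^{(b-2)}_{(a,t)} ∘ R`, and algebraic
  self-correspondences form a `ℂ`-linear category, part XXII-e of the AbelianAll André axis), and the primitive
  part `ξ_p : Hᵇ → Hᵃ` itself (`isAlgebraicCorrespondence_primitivePart`).

Nothing here is a case of the Hodge conjecture or of `B(X)`; no definition, no named fact, no sorry.
References: [Charles2013] = F. Charles, *Remarks on the Lefschetz standard conjecture and hyperkähler varieties*,
Comment. Math. Helv. 88 (2013) (arXiv:1002.5011), Lemma 7 and Prop. 8; [VoisinHodgeI2002] §6.2.3 Cor. 6.26,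
Rem. 6.27; [Andre1996Motifs] §1.1, Prop. 1.2; [Kleiman1968AlgebraicCycles] §1.4, §2; [Fulton1998] §16.1.
-/

noncomputable section

-- every declaration of this problem lives in `Summit.HodgeConjecture.HodgeConjecture.…` (summit = sub-problem)
set_option linter.dupNamespace false

open CategoryTheory AlgebraicGeometry
open Literature.AlgebraicGeometry.Motives Literature.AlgebraicGeometry.HodgeTheory
open Literature.Geometry.Kaehler (lefschetzOperator lefschetzPow HasHardLefschetzProperty lefschetzOperator_apply)
open Literature.AlgebraicTopology.SingularHomology (singularCohomology)
open Summit.HodgeConjecture.HodgeConjecture.Ring2.AbelianAll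

namespace Summit.HodgeConjecture.HodgeConjecture.Theorems.LefschetzStandardB

variable {l : ℕ} {S : SchemeOver ℂ}

/-! ## §1 Bookkeeping: Lefschetz iterates with explicit target degree inside algebraic correspondences -/

/-- Precomposition with `Lʳ_κ : Hᵃ → Hᵐ` (explicit target degree `a + 2r = m`) keeps a correspondence algebraic,
for `κ ∈ N¹ H²(S(ℂ))` (`IsAlgebraicCorrespondence.comp_lefschetzPow` after the degree substitution).
[cite: VoisinHodgeII2003, §9.2.4 Prop. 9.20 and proof of Thm. 10.17 (10.7)] -/
theorem IsAlgebraicCorrespondence.comp_lefschetzPowTo {m n : ℕ} {W X : SchemeOver ℂ} (hW : IsSmoothProjective m W)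
    (hX : IsSmoothProjective n X) {κ : complexBetti X 2} (hκ : κ ∈ algebraicClasses X 1) {a r c b : ℕ}
    (h : a + 2 * r = c) {T : complexBetti X c →ₗ[ℂ] complexBetti W b} (hT : IsAlgebraicCorrespondence m n W X T) :
    IsAlgebraicCorrespondence m n W X (T ∘ₗ lefschetzPowTo κ r a c h) := by
  subst h
  exact IsAlgebraicCorrespondence.comp_lefschetzPow hW hX hκ a r hT

/-- The identity of `Hᵃ(S(ℂ); ℂ)` (`a ≤ 2 dim S`) is an algebraic correspondence (`[Δ]^* = (𝟙 S)^*`).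
[cite: Andre1996Motifs, §2.1 (p. 15)] -/
theorem isAlgebraicCorrespondence_id (hS : IsSmoothProjective l S) {a : ℕ} (ha : a ≤ 2 * l) :
    IsAlgebraicCorrespondence l l S S (LinearMap.id : complexBetti S a →ₗ[ℂ] complexBetti S a) := by
  have h := isAlgebraicCorrespondence_map hS hS (𝟙 S) ha
  rw [complexBetti.map_id] at h
  exact h

/-- `Lʳ_κ : Hᵃ(S(ℂ)) → Hᵐ(S(ℂ))` (`a + 2r = m ≤ 2 dim S`) is an algebraic correspondence for `κ ∈ N¹ H²`
(`𝟙 ∘ Lʳ`; the class is `Δ_* κʳ`). [cite: Andre1996Motifs, §1.1 (p. 10)] [cite: VoisinHodgeII2003, §9.2.4 Prop. 9.20] -/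
theorem isAlgebraicCorrespondence_lefschetzPowTo (hS : IsSmoothProjective l S) {κ : complexBetti S 2}
    (hκ : κ ∈ algebraicClasses S 1) {a r m : ℕ} (h : a + 2 * r = m) (hm : m ≤ 2 * l) :
    IsAlgebraicCorrespondence l l S S (lefschetzPowTo κ r a m h) := by
  have h1 := IsAlgebraicCorrespondence.comp_lefschetzPowTo hS hS hκ h (isAlgebraicCorrespondence_id hS hm)
  rwa [LinearMap.id_comp] at h1

/-- `L_κ : Hᶜ → H^{c+2}` written as `lefschetzPowTo κ 1`. [folklore] -/
theorem lefschetzOperator_eq_lefschetzPowTo_one (κ : complexBetti S 2) {c d : ℕ} (h : 2 + c = d) (h' : c + 2 * 1 = d) :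
    lefschetzOperator κ h = lefschetzPowTo κ 1 c d h' := by
  refine LinearMap.ext fun x ↦ ?_
  rw [lefschetzPowTo_succ_apply κ 0 c c d rfl h' h x, lefschetzPowTo_zero_apply]

/-! ## §2 The one-step descent of the Lefschetz decomposition -/

section Descent

variable {κ : complexBetti S 2} (hL : HasHardLefschetzProperty κ l)
  (hvan : ∀ m, 2 * l < m → Subsingleton (complexBetti S m))

/-- **The descent operator is well placed**: for `c + 2 ≤ l`, `c + j = l`, `j = j₁ + 1`, `x ∈ H^{c+2}(S(ℂ))` and
`R x := *_L (L^{j₁} x) ∈ Hᶜ` (`*_L : H^{c+2j} → Hᶜ` the inverse of `Lʲ`), the class `x − L (R x)` is PRIMITIVE: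
`L^{j₁}(x − L R x) = L^{j₁} x − Lʲ (*_L (L^{j₁} x)) = 0`. [cite: VoisinHodgeI2002, §6.2.3 Cor. 6.26 (proof)] -/
theorem sub_lefschetzOperator_mem_primitiveClasses {c j₁ : ℕ} (hcl : c + 2 ≤ l) (hj : c + (j₁ + 1) = l)
    (hR : c + 2 * (j₁ + 1) + c = 2 * l) (hm : c + 2 + 2 * j₁ = c + 2 * (j₁ + 1)) (x : complexBetti S (c + 2)) :
    x - lefschetzOperator κ (by omega : 2 + c = c + 2)
        (lefschetzInvolution hL hR (lefschetzPowTo κ j₁ (c + 2) (c + 2 * (j₁ + 1)) hm x)) ∈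
      primitiveClasses κ l (c + 2) := by
  refine ⟨fun h ↦ absurd h (by omega), fun r m h hr ↦ ?_⟩
  obtain rfl : j₁ = r := by omega
  obtain rfl : m = c + 2 * (j₁ + 1) := by omega
  rw [map_sub, sub_eq_zero, lefschetzPowTo_lefschetzOperator κ j₁ (by omega : 2 + c = c + 2) h rfl,
    lefschetzPowTo_eq_lefschetzPow, lefschetzPow_lefschetzInvolution hL hj hR]

/-- The Lefschetz decomposition of `x ∈ H^{c+2}` read off the descent: with `y = R x`,
`x = L⁰ (x − L y) + ∑_{(a,t)} L^{t+1} ξ_{(a,t)} y`. [cite: VoisinHodgeI2002, §6.2.3 Cor. 6.26] -/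
theorem eq_lefschetzPowTo_sub_add_sum {c : ℕ} (x : complexBetti S (c + 2)) (y : complexBetti S c) :
    x = lefschetzPowTo κ 0 (c + 2) (c + 2) rfl (x - lefschetzOperator κ (by omega : 2 + c = c + 2) y) +
      ∑ p : {p : ℕ × ℕ // p.1 + 2 * p.2 = c},
        lefschetzPowTo κ (p.1.2 + 1) p.1.1 (c + 2) (by have := p.2; omega) (primitivePart κ l hL hvan p y) := by
  rw [lefschetzPowTo_zero_apply]
  have hLy : lefschetzOperator κ (by omega : 2 + c = c + 2) y =
      ∑ p : {p : ℕ × ℕ // p.1 + 2 * p.2 = c},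
        lefschetzPowTo κ (p.1.2 + 1) p.1.1 (c + 2) (by have := p.2; omega) (primitivePart κ l hL hvan p y) := by
    conv_lhs => rw [← sum_lefschetzPowTo_primitivePart hL hvan y]
    rw [map_sum]
    refine Finset.sum_congr rfl fun p _ ↦ ?_
    rw [lefschetzPowTo_succ_apply κ p.1.2 p.1.1 c (c + 2) p.2 (by have := p.2; omega) (by omega)]
  rw [← hLy, sub_add_cancel]

/-- **`ξ_{(c+2,0)} x = x − L (R x)`**: the top primitive part of `x ∈ H^{c+2}` (`c + 2 ≤ l`) is `x` minus `L` of the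
descent `R x = *_L (L^{j₁} x)`, `c + j₁ + 1 = l`. Proof: `x = (x − L R x) + L (∑_p Lᵗ ξ_p (R x))` is a Lefschetz
decomposition of `x` (the first summand is primitive, `sub_lefschetzOperator_mem_primitiveClasses`), and the
decomposition is unique (`primitivePart_lefschetzPowTo_of_mem`, `primitivePart_eq_zero_of_mem_ne`).
[cite: VoisinHodgeI2002, §6.2.3 Cor. 6.26] -/
theorem primitivePart_top_eq_sub {c j₁ : ℕ} (hcl : c + 2 ≤ l) (hj : c + (j₁ + 1) = l)
    (hR : c + 2 * (j₁ + 1) + c = 2 * l) (hm : c + 2 + 2 * j₁ = c + 2 * (j₁ + 1)) (x : complexBetti S (c + 2)) :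
    primitivePart κ l hL hvan (⟨(c + 2, 0), rfl⟩ : {p : ℕ × ℕ // p.1 + 2 * p.2 = c + 2}) x =
      x - lefschetzOperator κ (by omega : 2 + c = c + 2)
        (lefschetzInvolution hL hR (lefschetzPowTo κ j₁ (c + 2) (c + 2 * (j₁ + 1)) hm x)) := by
  set y := lefschetzInvolution hL hR (lefschetzPowTo κ j₁ (c + 2) (c + 2 * (j₁ + 1)) hm x) with hy
  have hprim := sub_lefschetzOperator_mem_primitiveClasses hL hcl hj hR hm x
  rw [← hy] at hprim
  conv_lhs => rw [eq_lefschetzPowTo_sub_add_sum hL hvan x y]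
  rw [map_add, map_sum, primitivePart_lefschetzPowTo_of_mem hL hvan (⟨(c + 2, 0), rfl⟩ : {p : ℕ × ℕ // p.1 + 2 * p.2 = c + 2})
    (by simp only; omega) hprim, Finset.sum_eq_zero, add_zero]
  intro p _
  refine primitivePart_eq_zero_of_mem_ne hL hvan (p := (⟨(p.1.1, p.1.2 + 1), by have := p.2; omega⟩ : {p : ℕ × ℕ // p.1 + 2 * p.2 = c + 2})) ?_
    (lefschetzPowTo_mem_lefschetzSummand _ (primitivePart_mem hL hvan p y))
  intro h
  have h' := congrArg (fun q : {p : ℕ × ℕ // p.1 + 2 * p.2 = c + 2} ↦ q.1.2) h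
  simp at h'

/-- **`ξ_{(a,t+1)} x = ξ_{(a,t)} (R x)`**: the lower primitive parts of `x ∈ H^{c+2}` (`c + 2 ≤ l`) are the primitive
parts of its descent `R x = *_L (L^{j₁} x) ∈ Hᶜ` (same Lefschetz decomposition, uniqueness).
[cite: VoisinHodgeI2002, §6.2.3 Cor. 6.26] -/
theorem primitivePart_succ_eq {c j₁ : ℕ} (hcl : c + 2 ≤ l) (hj : c + (j₁ + 1) = l)
    (hR : c + 2 * (j₁ + 1) + c = 2 * l) (hm : c + 2 + 2 * j₁ = c + 2 * (j₁ + 1)) (x : complexBetti S (c + 2))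
    (q : {p : ℕ × ℕ // p.1 + 2 * p.2 = c}) :
    primitivePart κ l hL hvan (⟨(q.1.1, q.1.2 + 1), by have := q.2; omega⟩ : {p : ℕ × ℕ // p.1 + 2 * p.2 = c + 2}) x =
      primitivePart κ l hL hvan q
        (lefschetzInvolution hL hR (lefschetzPowTo κ j₁ (c + 2) (c + 2 * (j₁ + 1)) hm x)) := by
  set y := lefschetzInvolution hL hR (lefschetzPowTo κ j₁ (c + 2) (c + 2 * (j₁ + 1)) hm x) with hy
  have hprim := sub_lefschetzOperator_mem_primitiveClasses hL hcl hj hR hm x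
  rw [← hy] at hprim
  conv_lhs => rw [eq_lefschetzPowTo_sub_add_sum hL hvan x y]
  rw [map_add, map_sum]
  -- the top summand contributes `0`
  rw [primitivePart_eq_zero_of_mem_ne hL hvan (p := (⟨(c + 2, 0), rfl⟩ : {p : ℕ × ℕ // p.1 + 2 * p.2 = c + 2})) (fun h ↦ by
      have h' := congrArg (fun r : {p : ℕ × ℕ // p.1 + 2 * p.2 = c + 2} ↦ r.1.2) h
      simp at h')
    (lefschetzPowTo_mem_lefschetzSummand _ hprim), zero_add]
  -- exactly the summand `p = q` survives
  rw [Finset.sum_eq_single q]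
  · exact primitivePart_lefschetzPowTo_of_mem hL hvan (⟨(q.1.1, q.1.2 + 1), by have := q.2; omega⟩ : {p : ℕ × ℕ // p.1 + 2 * p.2 = c + 2})
      (by have := q.2; simp only; omega) (primitivePart_mem hL hvan q y)
  · intro p _ hpq
    refine primitivePart_eq_zero_of_mem_ne hL hvan (p := (⟨(p.1.1, p.1.2 + 1), by have := p.2; omega⟩ : {p : ℕ × ℕ // p.1 + 2 * p.2 = c + 2}))
      ?_ (lefschetzPowTo_mem_lefschetzSummand _ (primitivePart_mem hL hvan p y))
    intro h
    apply hpq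
    have h1 := congrArg (fun r : {p : ℕ × ℕ // p.1 + 2 * p.2 = c + 2} ↦ r.1.1) h
    have h2 := congrArg (fun r : {p : ℕ × ℕ // p.1 + 2 * p.2 = c + 2} ↦ r.1.2) h
    simp only [add_left_inj] at h1 h2
    exact Subtype.ext (Prod.ext h1 h2)
  · intro h
    exact absurd (Finset.mem_univ q) h

end Descent

/-! ## §3 The Lefschetz projections are algebraic correspondences (Charles 2013, Lemma 7) -/

/-- **Charles's Lemma 7 on the real carriers.** For `S` smooth projective of dimension `l`, a polarisation class
`κ`, and a degree `b ≤ l`: if the Lefschetz involution `*_L : Hᵃ'(S(ℂ); ℂ) → Hᵇ'(S(ℂ); ℂ)` is an algebraic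
correspondence for all `a' + b' = 2l` with `b' + 2 ≤ b` (conjecture `B(S)` in the target degrees `≤ b − 2`), then for
every Lefschetz index `p = (a, t)` with `a + 2t = b` the projection `Lᵗ ∘ ξ_p` of `Hᵇ(S(ℂ); ℂ)` onto the component
`Lᵗ Pᵃ` of the Lefschetz decomposition `Hᵇ = ⨁ Lᵗ Pᵃ` is induced by an algebraic class on `S × S`. By strong induction
on `b`: for `b ≤ 1` the only index is `(b, 0)` and the projection is `𝟙`; for `b = c + 2`, with the descent
`R = *_L ∘ L^{j-1} : H^{c+2} → Hᶜ` (algebraic: `*_L` into degree `c ≤ b − 2` is granted, `L^{j-1}` is a Lefschetz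
iterate of a divisor class), `π_{(c+2,0)} = 𝟙 − L ∘ R` and `π_{(a,t+1)} = L ∘ π^{(c)}_{(a,t)} ∘ R`.
[cite: Charles2013, Lemma 7 (arXiv:1002.5011)] [cite: VoisinHodgeI2002, §6.2.3 Cor. 6.26] [cite: Andre1996Motifs, §1.1 and Prop. 1.2] -/
theorem isAlgebraicCorrespondence_lefschetzProjection (hS : IsSmoothProjective l S) {κ : complexBetti S 2}
    (hκ : IsPolarizationClass l S κ) (hvan : ∀ m, 2 * l < m → Subsingleton (complexBetti S m)) :
    ∀ (b : ℕ), b ≤ l →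
      (∀ (a' b' : ℕ) (hab' : a' + b' = 2 * l), b' + 2 ≤ b →
        IsAlgebraicCorrespondence l l S S (lefschetzInvolution hκ.hasHardLefschetz hab')) →
      ∀ p : {p : ℕ × ℕ // p.1 + 2 * p.2 = b},
        IsAlgebraicCorrespondence l l S S
          (lefschetzPowTo κ p.1.2 p.1.1 b p.2 ∘ₗ primitivePart κ l hκ.hasHardLefschetz hvan p) := by
  intro b
  induction b using Nat.strong_induction_on with
  | _ b ih =>
  intro hbl hB p
  have hL := hκ.hasHardLefschetz
  rcases Nat.lt_or_ge b 2 with hb2 | hb2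
  · -- `b ≤ 1`: the only index is `(b, 0)` and every class of `Hᵇ` is primitive, so the projection is `𝟙`
    obtain ⟨⟨a, t⟩, hp⟩ := p
    obtain rfl : t = 0 := by simp only at hp; omega
    obtain rfl : a = b := by simpa using hp
    have hall : ∀ x : complexBetti S a, x ∈ primitiveClasses κ l a := by
      intro x
      refine ⟨fun h ↦ ?_, fun r m h hr ↦ ?_⟩
      · haveI := hvan a (by omega)
        exact Subsingleton.elim _ _
      · haveI := hvan m (by omega)
        exact Subsingleton.elim _ _
    have heq : lefschetzPowTo κ 0 a a hp ∘ₗ primitivePart κ l hL hvan ⟨(a, 0), hp⟩ = LinearMap.id := by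
      refine LinearMap.ext fun x ↦ ?_
      rw [LinearMap.comp_apply, LinearMap.id_apply, lefschetzPowTo_zero_eq_id, LinearMap.id_apply]
      have h := primitivePart_lefschetzPowTo_of_mem hL hvan ⟨(a, 0), hp⟩ (by simp only; omega) (hall x)
      rwa [lefschetzPowTo_zero_eq_id, LinearMap.id_apply] at h
    rw [heq]
    exact isAlgebraicCorrespondence_id hS (by omega)
  · -- `b = c + 2`: descent
    obtain ⟨c, rfl⟩ : ∃ c, b = c + 2 := ⟨b - 2, by omega⟩
    obtain ⟨j₁, hj⟩ : ∃ j₁, c + (j₁ + 1) = l := ⟨l - c - 1, by omega⟩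
    have hR : c + 2 * (j₁ + 1) + c = 2 * l := by omega
    have hm : c + 2 + 2 * j₁ = c + 2 * (j₁ + 1) := by omega
    -- the descent operator `R = *_L ∘ L^{j₁}` and `L`, both algebraic
    set R : complexBetti S (c + 2) →ₗ[ℂ] complexBetti S c :=
      lefschetzInvolution hL hR ∘ₗ lefschetzPowTo κ j₁ (c + 2) (c + 2 * (j₁ + 1)) hm with hRdef
    have hRalg : IsAlgebraicCorrespondence l l S S R :=
      IsAlgebraicCorrespondence.comp_lefschetzPowTo hS hS hκ.mem_algebraicClasses hm (hB _ _ hR le_rfl)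
    have hLalg : IsAlgebraicCorrespondence l l S S (lefschetzOperator κ (by omega : 2 + c = c + 2)) :=
      isAlgebraicCorrespondence_lefschetzOperator hS hκ.mem_algebraicClasses _ (by omega)
    have hRx : ∀ x, R x = lefschetzInvolution hL hR (lefschetzPowTo κ j₁ (c + 2) (c + 2 * (j₁ + 1)) hm x) :=
      fun x ↦ rfl
    obtain ⟨⟨a, t⟩, hp⟩ := p
    rcases Nat.eq_zero_or_pos t with rfl | ht
    · -- the top index `(c+2, 0)`: `π = ξ_{(c+2,0)} = 𝟙 − L ∘ R`
      obtain rfl : a = c + 2 := by simpa using hp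
      have heq : lefschetzPowTo κ 0 (c + 2) (c + 2) hp ∘ₗ primitivePart κ l hL hvan ⟨(c + 2, 0), hp⟩ =
          LinearMap.id - lefschetzOperator κ (by omega : 2 + c = c + 2) ∘ₗ R := by
        refine LinearMap.ext fun x ↦ ?_
        rw [LinearMap.comp_apply, lefschetzPowTo_zero_eq_id, LinearMap.id_apply, LinearMap.sub_apply,
          LinearMap.id_apply, LinearMap.comp_apply, hRx]
        exact primitivePart_top_eq_sub hL hvan hbl hj hR hm x
      rw [heq]
      exact IsAlgebraicCorrespondence.sub hS hS (isAlgebraicCorrespondence_id hS (by omega))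
        (IsAlgebraicCorrespondence.comp hS hS hS hRalg hLalg (by omega))
    · -- a lower index `(a, t'+1)`: `π = L ∘ π^{(c)}_{(a,t')} ∘ R`
      obtain ⟨t', rfl⟩ : ∃ t', t = t' + 1 := ⟨t - 1, by omega⟩
      have hq : a + 2 * t' = c := by simp only at hp; omega
      let q : {p : ℕ × ℕ // p.1 + 2 * p.2 = c} := ⟨(a, t'), hq⟩
      have hIH := ih c (by omega) (by omega) (fun a' b' hab' hb' ↦ hB a' b' hab' (by omega)) q
      have heq : lefschetzPowTo κ (t' + 1) a (c + 2) hp ∘ₗ primitivePart κ l hL hvan ⟨(a, t' + 1), hp⟩ =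
          lefschetzOperator κ (by omega : 2 + c = c + 2) ∘ₗ
            (lefschetzPowTo κ q.1.2 q.1.1 c q.2 ∘ₗ primitivePart κ l hL hvan q) ∘ₗ R := by
        refine LinearMap.ext fun x ↦ ?_
        simp only [LinearMap.comp_apply]
        rw [lefschetzPowTo_succ_apply κ t' a c (c + 2) hq hp (by omega), hRx]
        congr 2
        exact primitivePart_succ_eq hL hvan hbl hj hR hm x q
      rw [heq]
      exact IsAlgebraicCorrespondence.comp hS hS hS
        (IsAlgebraicCorrespondence.comp hS hS hS hRalg hIH (by omega)) hLalg (by omega)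

/-- **The primitive parts are algebraic correspondences** under the same hypothesis: `ξ_p : Hᵇ(S(ℂ)) → Hᵃ(S(ℂ))`,
`p = (a, t)`, `a + 2t = b ≤ l`, is induced by an algebraic class on `S × S` — `ξ_p = *_L ∘ L^{l-a-t} ∘ (Lᵗ ∘ ξ_p)`
with `*_L : H^{2l-a} → Hᵃ` granted when `t ≥ 1` (`a + 2 ≤ b`), and `ξ_{(b,0)}` the projection itself.
[cite: Charles2013, Lemma 7 (arXiv:1002.5011)] [cite: VoisinHodgeI2002, §6.2.3 Cor. 6.26] -/
theorem isAlgebraicCorrespondence_primitivePart (hS : IsSmoothProjective l S) {κ : complexBetti S 2}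
    (hκ : IsPolarizationClass l S κ) (hvan : ∀ m, 2 * l < m → Subsingleton (complexBetti S m)) {b : ℕ}
    (hbl : b ≤ l)
    (hB : ∀ (a' b' : ℕ) (hab' : a' + b' = 2 * l), b' + 2 ≤ b →
      IsAlgebraicCorrespondence l l S S (lefschetzInvolution hκ.hasHardLefschetz hab'))
    (p : {p : ℕ × ℕ // p.1 + 2 * p.2 = b}) :
    IsAlgebraicCorrespondence l l S S (primitivePart κ l hκ.hasHardLefschetz hvan p) := by
  have hL := hκ.hasHardLefschetz
  obtain ⟨⟨a, t⟩, hp⟩ := p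
  have hπ := isAlgebraicCorrespondence_lefschetzProjection hS hκ hvan b hbl hB ⟨(a, t), hp⟩
  rcases Nat.eq_zero_or_pos t with rfl | ht
  · obtain rfl : b = a := by simp only at hp; omega
    rwa [lefschetzPowTo_zero_eq_id, LinearMap.id_comp] at hπ
  · -- `ξ_p = *_L ∘ L^{s} ∘ (Lᵗ ∘ ξ_p)` with `b + s = 2l - a`, `*_L : H^{a + 2(l-a)} → Hᵃ`
    simp only at hp
    obtain ⟨u, hu⟩ : ∃ u, a + u = l := ⟨l - a, by omega⟩
    obtain ⟨s, hs⟩ : ∃ s, t + s = u := ⟨u - t, by omega⟩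
    have hba : b + 2 * s = a + 2 * u := by omega
    have hinv : a + 2 * u + a = 2 * l := by omega
    have heq : primitivePart κ l hL hvan ⟨(a, t), hp⟩ =
        (lefschetzInvolution hL hinv ∘ₗ lefschetzPowTo κ s b (a + 2 * u) hba) ∘ₗ
          (lefschetzPowTo κ t a b hp ∘ₗ primitivePart κ l hL hvan ⟨(a, t), hp⟩) := by
      refine LinearMap.ext fun x ↦ ?_
      simp only [LinearMap.comp_apply]
      rw [lefschetzPowTo_lefschetzPowTo κ s hp hba (by omega : a + 2 * (t + s) = a + 2 * u)]
      have h := lefschetzInvolution_lefschetzPow hL hu hinv (primitivePart κ l hL hvan ⟨(a, t), hp⟩ x)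
      rw [← lefschetzPowTo_eq_lefschetzPow] at h
      rw [lefschetzPowTo_congr_exponent κ (by omega : t + s = u) _ rfl, h]
    rw [heq]
    exact IsAlgebraicCorrespondence.comp hS hS hS hπ
      (IsAlgebraicCorrespondence.comp_lefschetzPowTo hS hS hκ.mem_algebraicClasses hba (hB _ _ hinv (by omega)))
      (by omega)

end Summit.HodgeConjecture.HodgeConjecture.Theorems.LefschetzStandardB

end
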